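import Mathlib.MeasureTheory.Integral.IntervalIntegral.FundThmCalculus
import Mathlib.MeasureTheory.Function.LocallyIntegrable
import Mathlib.Analysis.SpecialFunctions.Log.Deriv
import Mathlib.Analysis.Complex.ExponentialBounds
import HarnessLib

/-!
# The logarithmic Hardy inequality near the horizon:
# `∫₀ˢ f²/(x(1 + |log(x/s)|)²) ≤ 4 max(s, t − s) ∫₀ᵗ (f')² + (4/(t − s)) ∫ₛᵗ f²`

(namespace `Literature.Analysis.Calculus`; companion of `HardyHalfLine.lean`)

Dafermos–Rodnianski–Shlapentokh-Rothman, *Decay for solutions of the wave equation on Kerr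
exterior spacetimes III: the full subextremal case `|a| < M`*, arXiv:1402.7034 = Ann. of Math. 183
(2016), §4.3 ("Hardy inequalities"), first display, record the one-dimensional inequality from
which "the reader can easily derive" the Hardy inequalities used near the event horizon:

  `∫₀² x⁻¹ |log x|⁻² f²(x) dx ≤ C ∫₀² (df/dx)² dx + C ∫₁² f²(x) dx`        (DRSR §4.3)

(verbatim also in Dafermos–Rodnianski, arXiv:1010.5132, §4.3). It supplies the zeroth-order term
`|log(r − r₊)|⁻² (r − r₊)⁻¹ Ψ²` on the left of the red-shift estimate, loc. cit. Prop. 4.5.2 ("the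
proof of this estimate uses the Hardy inequality (hardy1), so as to include the useful zeroth
order term"), and is invoked again in §§9.2, 9.6 and 10.1 of the proof of the integrated local
energy decay statement (25) of their Theorem 3.2. The second display of §4.3 (Hardy at infinity)
is `hardy_sq_integral_Ioi_one_le` in `HardyHalfLine.lean`.

**Reading of the display.** Only the behaviour of the weight as `x → 0⁺` (i.e. `r → r₊`) is used.
Read literally on all of `(0, 2)` the displayed weight `x⁻¹|log x|⁻²` is not locally integrable at
`x = 1` (`|log x|⁻² ∼ (x − 1)⁻²`), so the display cannot hold as printed for, e.g., `f ≡ 1` near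
`x = 1`; the intended statement concerns the weight near `0`, where `x⁻¹|log x|⁻²` has the
integrable primitive `|log x|⁻¹`. We therefore prove the inequality with the weight regularised
away from `0`, `x⁻¹ (1 + |log x|)⁻²` (comparable to the printed weight on `(0, 1/2]`, where
`|log x| ≤ 1 + |log x| ≤ 3|log x|`), and in scale-covariant form: for `0 < s < t` and
`f ∈ C¹[0, t]`,

  `∫₀ˢ f²/(x (1 + |log(x/s)|)²) dx ≤ 4 max(s, t − s) ∫₀ᵗ (f')² dx + (4/(t − s)) ∫ₛᵗ f² dx`

(`hardy_log_sq_integral_le`), whence the printed shape for `s = 1`, `t = 2` with `C = 4`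
(`hardy_log_sq_integral_le_one_two`: `∫₀¹ x⁻¹(1 + |log x|)⁻² f² ≤ 4 ∫₀² (f')² + 4 ∫₁² f²`), the
same with the left-hand integral over `(0, 2)` and constants `(4, 5)`
(`hardy_log_sq_integral_Ioo_zero_two_le`), and the printed weight itself on `(0, 1/2]` with
`C = 36` (`hardy_log_sq_integral_printed_half`:
`∫₀^{1/2} x⁻¹ |log x|⁻² f² ≤ 36 ∫₀² (f')² + 36 ∫₁² f²`).

## Proof

With `L(x) = 1 − log(x/s) = 1 + |log(x/s)| ≥ 1` on `(0, s]`, the weight `w = 1/(x L²)` has the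
bounded increasing primitive `g = 1/L` on `(0, s]`, `g(0⁺) = 0`, `g(s) = 1`; hence `w ∈ L¹(0, s)`
and, by the fundamental theorem of calculus for `g f²` on `[0, s]`,
`∫₀ˢ (w f² + 2 g f f') = f(s)²`. Pointwise `−2 g f f' ≤ ½ w f² + 2 x (f')²`
(`(f + 2 x L f')² ≥ 0` divided by `2 x L²`), so `∫₀ˢ w f² ≤ 2 f(s)² + 4 ∫₀ˢ x (f')²`
(`hardy_log_core`). The boundary value is controlled by the elementary trace inequality
`f(s)² ≤ (2/(t − s)) ∫ₛᵗ f² + 2 (t − s) ∫ₛᵗ (f')²` (`sq_le_trace`: `|f(s)| ≤ |f(y)| + ∫ₛᵗ |f'|`,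
`(∫ₛᵗ |f'|)² ≤ (t − s) ∫ₛᵗ (f')²`, averaged over `y ∈ [s, t]`).

Regularity: `f` is assumed differentiable at every point of the closed interval with a derivative
`f'` continuous on it (so any `C¹` function on a neighbourhood of the interval qualifies); Mathlib
has no Hardy inequality of this kind. Everything below is proved; no named facts.

## References

* M. Dafermos, I. Rodnianski, Y. Shlapentokh-Rothman, arXiv:1402.7034 = Ann. of Math. 183 (2016),
  §4.3, first display; Prop. 4.5.2 (key `DafermosRodnianskiShlapentokhrothman2014`).
* M. Dafermos, I. Rodnianski, arXiv:1010.5132, §4.3 (key `DafermosRodnianski2010KerrSmallA`).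
-/

noncomputable section

open MeasureTheory Set Filter intervalIntegral
open scoped Topology

namespace Literature.Analysis.Calculus

/-! ### The primitive `1/(1 − log(x/s))` of the weight on `(0, s]` -/

/-- The weight `x⁻¹ (1 − log(x/s))⁻²` on `(0, s]` has the primitive `g = (1 − log(x/s))⁻¹`, which
extends continuously by `0` to `x = 0` and equals `1` at `x = s`. [folklore] -/
theorem hardyLog_primitive {s : ℝ} (hs : 0 < s) :
    ∃ g : ℝ → ℝ, ContinuousOn g (Icc 0 s) ∧ g 0 = 0 ∧ g s = 1 ∧
      (∀ x ∈ Ioo 0 s, HasDerivAt g (x⁻¹ / (1 - Real.log (x / s)) ^ 2) x) ∧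
      ∀ x, 0 < x → g x = (1 - Real.log (x / s))⁻¹ := by
  set L : ℝ → ℝ := fun x ↦ 1 - Real.log (x / s) with hL
  set G : ℝ → ℝ := fun x ↦ if 0 < x then (L x)⁻¹ else 0 with hG
  have hLpos : ∀ x, 0 < x → x ≤ s → 1 ≤ L x := by
    intro x hx hxs
    have : Real.log (x / s) ≤ 0 := Real.log_nonpos (div_pos hx hs).le ((div_le_one hs).2 hxs)
    simp only [hL]
    linarith
  have hGeq : ∀ x, 0 < x → G x = (L x)⁻¹ := fun x hx ↦ by simp [hG, hx]
  have hG0 : G 0 = 0 := by simp [hG]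
  refine ⟨G, ?_, hG0, ?_, ?_, hGeq⟩
  · -- continuity on `[0, s]`
    intro x hx
    rcases hx.1.eq_or_lt with h0 | hx0
    · -- at `x = 0`: `L → +∞`, so `G → 0 = G 0`
      subst h0
      have h1 : Tendsto (fun y : ℝ ↦ y / s) (𝓝[>] 0) (𝓝[>] 0) := by
        refine tendsto_nhdsWithin_of_tendsto_nhds_of_eventually_within _ ?_ ?_
        · have : Tendsto (fun y : ℝ ↦ y / s) (𝓝 0) (𝓝 (0 / s)) :=
            (continuous_id.div_const s).tendsto 0
          rw [zero_div] at this
          exact this.mono_left nhdsWithin_le_nhds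
        · filter_upwards [self_mem_nhdsWithin] with y hy using div_pos hy hs
      have h2 : Tendsto (fun y : ℝ ↦ -Real.log (y / s)) (𝓝[>] 0) atTop :=
        tendsto_neg_atBot_atTop.comp (Real.tendsto_log_nhdsGT_zero.comp h1)
      have h3 : Tendsto L (𝓝[>] 0) atTop := by
        have := tendsto_atTop_add_const_left _ (1 : ℝ) h2
        simpa [hL, sub_eq_add_neg] using this
      have h4 : Tendsto (fun y ↦ (L y)⁻¹) (𝓝[>] 0) (𝓝 0) := h3.inv_tendsto_atTop
      have h5 : ContinuousWithinAt G (Ioi 0) 0 := by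
        show Tendsto G (𝓝[>] 0) (𝓝 (G 0))
        rw [hG0]
        refine h4.congr' ?_
        filter_upwards [self_mem_nhdsWithin] with y hy
        exact (hGeq y hy).symm
      refine (continuousWithinAt_insert_self.2 h5).mono fun y hy ↦ ?_
      rcases hy.1.eq_or_lt with h | h
      · exact Or.inl h.symm
      · exact Or.inr h
    · -- at `0 < x ≤ s`: `G = L⁻¹` near `x`, `L x ≠ 0`
      have hLx : L x ≠ 0 := by linarith [hLpos x hx0 hx.2]
      have hc : ContinuousAt (fun y ↦ (L y)⁻¹) x := by
        have hcL : ContinuousAt L x :=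
          continuousAt_const.sub ((continuousAt_id.div_const s).log (div_pos hx0 hs).ne')
        exact hcL.inv₀ hLx
      have heq : (fun y ↦ (L y)⁻¹) =ᶠ[𝓝 x] G := by
        filter_upwards [Ioi_mem_nhds hx0] with y hy
        exact (hGeq y hy).symm
      exact (hc.congr heq).continuousWithinAt
  · -- `G s = 1`
    rw [hGeq s hs]
    simp [hL, div_self hs.ne']
  · -- derivative on `(0, s)`
    intro x hx
    have hx0 := hx.1
    have hLx : L x ≠ 0 := by linarith [hLpos x hx0 hx.2.le]
    have h1 : HasDerivAt (fun y : ℝ ↦ y / s) (1 / s) x := (hasDerivAt_id' x).div_const s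
    have h2 : HasDerivAt (fun y : ℝ ↦ Real.log (y / s)) ((1 / s) / (x / s)) x :=
      h1.log (div_pos hx0 hs).ne'
    have h3 : HasDerivAt L (0 - (1 / s) / (x / s)) x := (hasDerivAt_const x (1 : ℝ)).sub h2
    have h4 : HasDerivAt (fun y ↦ (L y)⁻¹) (-(0 - (1 / s) / (x / s)) / (L x) ^ 2) x :=
      h3.inv hLx
    have h5 : HasDerivAt G (-(0 - (1 / s) / (x / s)) / (L x) ^ 2) x := by
      refine h4.congr_of_eventuallyEq ?_
      filter_upwards [Ioi_mem_nhds hx0] with y hy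
      exact hGeq y hy
    convert h5 using 1
    have hx' : x ≠ 0 := hx0.ne'
    have hs' : s ≠ 0 := hs.ne'
    simp only [hL]
    field_simp
    ring

/-- An algebraic rearrangement used repeatedly: `x⁻¹ / L² · F = F / (x L²)`. [folklore] -/
theorem inv_div_sq_mul_eq (x L F : ℝ) : x⁻¹ / L ^ 2 * F = F / (x * L ^ 2) := by
  rw [inv_eq_one_div, div_div, one_div_mul_eq_div]

/-- The weighted square `f²/(x (1 − log(x/s))²)` of a function continuous on `[0, s]` is integrable
on `(0, s]`: the weight has the bounded monotone primitive `(1 − log(x/s))⁻¹`. [folklore] -/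
theorem integrableOn_sq_div_mul_log_sq {s : ℝ} (hs : 0 < s) {f : ℝ → ℝ}
    (hfc : ContinuousOn f (Icc 0 s)) :
    IntegrableOn (fun x ↦ f x ^ 2 / (x * (1 - Real.log (x / s)) ^ 2)) (Ioc 0 s) := by
  obtain ⟨g, hgc, -, -, hgd, -⟩ := hardyLog_primitive hs
  have hw : IntegrableOn (fun x ↦ x⁻¹ / (1 - Real.log (x / s)) ^ 2) (Ioc 0 s) :=
    intervalIntegral.integrableOn_deriv_of_nonneg hgc hgd fun x hx ↦
      div_nonneg (inv_nonneg.2 hx.1.le) (sq_nonneg _)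
  have hw' : IntegrableOn (fun x ↦ x⁻¹ / (1 - Real.log (x / s)) ^ 2) (Icc 0 s) :=
    (integrableOn_Icc_iff_integrableOn_Ioc (by simp)).2 hw
  have h2 : IntegrableOn (fun x ↦ x⁻¹ / (1 - Real.log (x / s)) ^ 2 * f x ^ 2) (Icc 0 s) :=
    hw'.mul_continuousOn (hfc.pow 2) isCompact_Icc
  exact (h2.mono_set Ioc_subset_Icc_self).congr_fun (fun x _ ↦ inv_div_sq_mul_eq _ _ _)
    measurableSet_Ioc

/-! ### The core estimate on `(0, s]` and the trace inequality -/

/-- **Core logarithmic Hardy estimate.** For `s > 0` and `f` differentiable on `[0, s]` with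
continuous derivative `f'`,
`∫₀ˢ f²/(x (1 − log(x/s))²) dx ≤ 2 f(s)² + 4 ∫₀ˢ x f'(x)² dx`.
Proof: `∫₀ˢ (w f² + 2 g f f') = f(s)²` for `g = (1 − log(x/s))⁻¹`, `g' = w`, and
`−2 g f f' ≤ ½ w f² + 2 x (f')²`. Dafermos–Rodnianski–Shlapentokh-Rothman, arXiv:1402.7034, §4.3
(the inequality behind the first display). [cite: DafermosRodnianskiShlapentokhrothman2014, §4.3] -/
theorem hardy_log_core {s : ℝ} (hs : 0 < s) {f f' : ℝ → ℝ}
    (hf : ∀ x ∈ Icc 0 s, HasDerivAt f (f' x) x) (hf' : ContinuousOn f' (Icc 0 s)) :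
    ∫ x in Ioo 0 s, f x ^ 2 / (x * (1 - Real.log (x / s)) ^ 2) ≤
      2 * f s ^ 2 + 4 * ∫ x in Ioo 0 s, x * f' x ^ 2 := by
  obtain ⟨g, hgc, hg0, hgs, hgd, hgeq⟩ := hardyLog_primitive hs
  have hfc : ContinuousOn f (Icc 0 s) := fun x hx ↦ (hf x hx).continuousAt.continuousWithinAt
  have hLpos : ∀ x, 0 < x → x ≤ s → 1 ≤ 1 - Real.log (x / s) := by
    intro x hx hxs
    have : Real.log (x / s) ≤ 0 := Real.log_nonpos (div_pos hx hs).le ((div_le_one hs).2 hxs)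
    linarith
  -- integrability of the three integrands (`w = x⁻¹/(1 − log(x/s))²`)
  have hIw : IntegrableOn (fun x ↦ x⁻¹ / (1 - Real.log (x / s)) ^ 2 * f x ^ 2) (Ioc 0 s) :=
    (integrableOn_sq_div_mul_log_sq hs hfc).congr_fun (fun x _ ↦ (inv_div_sq_mul_eq _ _ _).symm)
      measurableSet_Ioc
  have hI1 : IntervalIntegrable (fun x ↦ x⁻¹ / (1 - Real.log (x / s)) ^ 2 * f x ^ 2) volume 0 s :=
    (intervalIntegrable_iff_integrableOn_Ioc_of_le hs.le).2 hIw
  have hI2c : ContinuousOn (fun x ↦ 2 * g x * f x * f' x) (Icc 0 s) :=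
    ((continuousOn_const.mul hgc).mul hfc).mul hf'
  have hI2 : IntervalIntegrable (fun x ↦ 2 * g x * f x * f' x) volume 0 s :=
    hI2c.intervalIntegrable_of_Icc hs.le
  have hI3 : IntervalIntegrable (fun x ↦ x * f' x ^ 2) volume 0 s :=
    (continuousOn_id.mul (hf'.pow 2)).intervalIntegrable_of_Icc hs.le
  -- the fundamental theorem of calculus for `g f²` on `[0, s]`
  have hH : ∀ x ∈ Ioo 0 s, HasDerivAt (fun y ↦ g y * f y ^ 2)
      (x⁻¹ / (1 - Real.log (x / s)) ^ 2 * f x ^ 2 + 2 * g x * f x * f' x) x := by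
    intro x hx
    refine ((hgd x hx).mul ((hf x ⟨hx.1.le, hx.2.le⟩).pow 2)).congr_deriv ?_
    simp only [Pi.pow_apply]
    push_cast
    ring
  have hcont : ContinuousOn (fun y ↦ g y * f y ^ 2) (Icc 0 s) := hgc.mul (hfc.pow 2)
  have hFTC : (∫ x in (0 : ℝ)..s, x⁻¹ / (1 - Real.log (x / s)) ^ 2 * f x ^ 2) +
      ∫ x in (0 : ℝ)..s, 2 * g x * f x * f' x = f s ^ 2 := by
    have := intervalIntegral.integral_eq_sub_of_hasDerivAt_of_le hs.le hcont hH (hI1.add hI2)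
    rw [intervalIntegral.integral_add hI1 hI2, hg0, hgs] at this
    linarith
  -- pointwise `−2 g f f' ≤ ½ w f² + 2 x f'²` on `(0, s)`
  have hpt : ∀ x ∈ Ioo 0 s, -(2 * g x * f x * f' x) ≤
      1 / 2 * (x⁻¹ / (1 - Real.log (x / s)) ^ 2 * f x ^ 2) + 2 * (x * f' x ^ 2) := by
    intro x hx
    have hx0 := hx.1
    have hLx : 0 < 1 - Real.log (x / s) := lt_of_lt_of_le one_pos (hLpos x hx0 hx.2.le)
    rw [hgeq x hx0]
    have key : 1 / 2 * (x⁻¹ / (1 - Real.log (x / s)) ^ 2 * f x ^ 2) + 2 * (x * f' x ^ 2) +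
        2 * (1 - Real.log (x / s))⁻¹ * f x * f' x =
        (f x + 2 * x * (1 - Real.log (x / s)) * f' x) ^ 2 /
          (2 * x * (1 - Real.log (x / s)) ^ 2) := by
      field_simp
      ring
    have hsq : 0 ≤ (f x + 2 * x * (1 - Real.log (x / s)) * f' x) ^ 2 /
        (2 * x * (1 - Real.log (x / s)) ^ 2) := by positivity
    linarith
  have hmono : (∫ x in (0 : ℝ)..s, -(2 * g x * f x * f' x)) ≤ ∫ x in (0 : ℝ)..s,
      (1 / 2 * (x⁻¹ / (1 - Real.log (x / s)) ^ 2 * f x ^ 2) + 2 * (x * f' x ^ 2)) :=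
    intervalIntegral.integral_mono_on_of_le_Ioo hs.le hI2.neg
      ((hI1.const_mul _).add (hI3.const_mul _)) hpt
  rw [intervalIntegral.integral_neg, intervalIntegral.integral_add (hI1.const_mul _)
    (hI3.const_mul _), intervalIntegral.integral_const_mul,
    intervalIntegral.integral_const_mul] at hmono
  -- back to set integrals over `(0, s)`
  have e1 : ∫ x in Ioo 0 s, f x ^ 2 / (x * (1 - Real.log (x / s)) ^ 2) =
      ∫ x in (0 : ℝ)..s, x⁻¹ / (1 - Real.log (x / s)) ^ 2 * f x ^ 2 := by
    rw [intervalIntegral.integral_of_le hs.le, integral_Ioc_eq_integral_Ioo]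
    exact setIntegral_congr_fun measurableSet_Ioo fun x _ ↦ (inv_div_sq_mul_eq _ _ _).symm
  have e2 : ∫ x in Ioo 0 s, x * f' x ^ 2 = ∫ x in (0 : ℝ)..s, x * f' x ^ 2 := by
    rw [intervalIntegral.integral_of_le hs.le, integral_Ioc_eq_integral_Ioo]
  rw [e1, e2]
  linarith

/-- **Trace inequality on an interval.** For `s < t` and `f` differentiable on `[s, t]` with
continuous derivative, `f(s)² ≤ (2/(t − s)) ∫ₛᵗ f² + 2 (t − s) ∫ₛᵗ (f')²`
(from `|f(s)| ≤ |f(y)| + ∫ₛᵗ |f'|` averaged over `y ∈ [s, t]` and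
`(∫ₛᵗ |f'|)² ≤ (t − s) ∫ₛᵗ (f')²`). [folklore] -/
theorem sq_le_trace {s t : ℝ} (hst : s < t) {f f' : ℝ → ℝ}
    (hf : ∀ x ∈ Icc s t, HasDerivAt f (f' x) x) (hf' : ContinuousOn f' (Icc s t)) :
    f s ^ 2 ≤ 2 / (t - s) * (∫ x in Ioo s t, f x ^ 2) + 2 * (t - s) * ∫ x in Ioo s t, f' x ^ 2 := by
  have hℓ : 0 < t - s := sub_pos.2 hst
  have hfc : ContinuousOn f (Icc s t) := fun x hx ↦ (hf x hx).continuousAt.continuousWithinAt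
  have habs : ContinuousOn (fun x ↦ |f' x|) (Icc s t) := continuous_abs.comp_continuousOn hf'
  have hIf2 : IntervalIntegrable (fun x ↦ f x ^ 2) volume s t :=
    (hfc.pow 2).intervalIntegrable_of_Icc hst.le
  have hIf'2 : IntervalIntegrable (fun x ↦ f' x ^ 2) volume s t :=
    (hf'.pow 2).intervalIntegrable_of_Icc hst.le
  have hIabs : IntervalIntegrable (fun x ↦ |f' x|) volume s t :=
    habs.intervalIntegrable_of_Icc hst.le
  set A := ∫ x in s..t, |f' x| with hA
  set B := ∫ x in s..t, f' x ^ 2 with hB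
  set F := ∫ x in s..t, f x ^ 2 with hF
  have hA0 : 0 ≤ A := intervalIntegral.integral_nonneg hst.le fun x _ ↦ abs_nonneg _
  -- (1) `A² ≤ (t − s) B` (Cauchy–Schwarz via the variance identity)
  have hA2 : A ^ 2 ≤ (t - s) * B := by
    set m := A / (t - s) with hm
    have h0 : 0 ≤ ∫ x in s..t, (|f' x| - m) ^ 2 :=
      intervalIntegral.integral_nonneg hst.le fun x _ ↦ sq_nonneg _
    have hexp : ∀ x, (|f' x| - m) ^ 2 = f' x ^ 2 - 2 * m * |f' x| + m ^ 2 := fun x ↦ by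
      rw [sub_sq, sq_abs]
      ring
    simp_rw [hexp] at h0
    rw [intervalIntegral.integral_add (hIf'2.sub (hIabs.const_mul _)) (by simp),
      intervalIntegral.integral_sub hIf'2 (hIabs.const_mul _),
      intervalIntegral.integral_const_mul, intervalIntegral.integral_const] at h0
    have e : B - 2 * m * A + (t - s) • m ^ 2 = B - A ^ 2 / (t - s) := by
      simp only [hm, smul_eq_mul]
      field_simp
      ring
    have h1 : 0 ≤ B - A ^ 2 / (t - s) := by
      have := h0
      simp only [← hA, ← hB] at this
      linarith [e]
    rw [sub_nonneg, div_le_iff₀ hℓ] at h1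
    linarith
  -- (2) pointwise `f(s)² ≤ 2 f(y)² + 2 A²` for `y ∈ [s, t]`
  have hpt : ∀ y ∈ Icc s t, f s ^ 2 ≤ 2 * f y ^ 2 + 2 * A ^ 2 := by
    intro y hy
    have hFTC : ∫ x in s..y, f' x = f y - f s := by
      apply intervalIntegral.integral_eq_sub_of_hasDerivAt
      · intro x hx
        rw [uIcc_of_le hy.1] at hx
        exact hf x ⟨hx.1, hx.2.trans hy.2⟩
      · exact (hf'.mono (Icc_subset_Icc_right hy.2)).intervalIntegrable_of_Icc hy.1
    have hbound : |f y - f s| ≤ A := by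
      rw [← hFTC]
      calc |∫ x in s..y, f' x| ≤ ∫ x in s..y, |f' x| :=
            intervalIntegral.abs_integral_le_integral_abs hy.1
        _ ≤ A := by
          have hadd : (∫ x in s..y, |f' x|) + ∫ x in y..t, |f' x| = A :=
            intervalIntegral.integral_add_adjacent_intervals
              ((habs.mono (Icc_subset_Icc_right hy.2)).intervalIntegrable_of_Icc hy.1)
              ((habs.mono (Icc_subset_Icc_left hy.1)).intervalIntegrable_of_Icc hy.2)
          have hnn : 0 ≤ ∫ x in y..t, |f' x| :=
            intervalIntegral.integral_nonneg hy.2 fun x _ ↦ abs_nonneg _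
          linarith
    have h1 : |f s| ≤ |f y| + A := by
      have := abs_sub_abs_le_abs_sub (f s) (f y)
      rw [abs_sub_comm] at this
      linarith
    have h2 : |f s| ^ 2 ≤ (|f y| + A) ^ 2 := pow_le_pow_left₀ (abs_nonneg _) h1 2
    rw [sq_abs] at h2
    nlinarith [h2, sq_nonneg (|f y| - A), sq_abs (f y)]
  -- (3) average over `y ∈ [s, t]`
  have hint : (t - s) * f s ^ 2 ≤ 2 * F + 2 * A ^ 2 * (t - s) := by
    have hmono := intervalIntegral.integral_mono_on hst.le (by simp)
      ((hIf2.const_mul 2).add (by simp)) hpt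
    rw [intervalIntegral.integral_const, intervalIntegral.integral_add (hIf2.const_mul 2) (by simp),
      intervalIntegral.integral_const_mul, intervalIntegral.integral_const] at hmono
    simp only [smul_eq_mul] at hmono
    linarith
  -- conclude, converting to set integrals over `(s, t)`
  have eF : ∫ x in Ioo s t, f x ^ 2 = F := by
    rw [hF, intervalIntegral.integral_of_le hst.le, integral_Ioc_eq_integral_Ioo]
  have eB : ∫ x in Ioo s t, f' x ^ 2 = B := by
    rw [hB, intervalIntegral.integral_of_le hst.le, integral_Ioc_eq_integral_Ioo]
  rw [eF, eB]
  have key : (t - s) * f s ^ 2 ≤ (t - s) * (2 / (t - s) * F + 2 * (t - s) * B) := by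
    have e : (t - s) * (2 / (t - s) * F + 2 * (t - s) * B) =
        2 * F + 2 * ((t - s) * B) * (t - s) := by
      field_simp
    rw [e]
    nlinarith [hint, hA2, hℓ]
  exact le_of_mul_le_mul_left key hℓ

/-! ### The inequality -/

/-- **Logarithmic Hardy inequality near the horizon** (Dafermos–Rodnianski–Shlapentokh-Rothman,
arXiv:1402.7034, §4.3, first display, in regularised scale-covariant form): for `0 < s < t` and `f`
differentiable on `[0, t]` with continuous derivative `f'`,
`∫₀ˢ f²/(x (1 + |log(x/s)|)²) dx ≤ 4 max(s, t − s) ∫₀ᵗ (f')² dx + (4/(t − s)) ∫ₛᵗ f² dx`.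
[cite: DafermosRodnianskiShlapentokhrothman2014, §4.3] -/
theorem hardy_log_sq_integral_le {s t : ℝ} (hs : 0 < s) (hst : s < t) {f f' : ℝ → ℝ}
    (hf : ∀ x ∈ Icc 0 t, HasDerivAt f (f' x) x) (hf' : ContinuousOn f' (Icc 0 t)) :
    ∫ x in Ioo 0 s, f x ^ 2 / (x * (1 + |Real.log (x / s)|) ^ 2) ≤
      4 * max s (t - s) * (∫ x in Ioo 0 t, f' x ^ 2) + 4 / (t - s) * ∫ x in Ioo s t, f x ^ 2 := by
  have hℓ : 0 < t - s := sub_pos.2 hst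
  have hfs : ∀ x ∈ Icc 0 s, HasDerivAt f (f' x) x := fun x hx ↦ hf x ⟨hx.1, hx.2.trans hst.le⟩
  have hf's : ContinuousOn f' (Icc 0 s) := hf'.mono (Icc_subset_Icc_right hst.le)
  have hft : ∀ x ∈ Icc s t, HasDerivAt f (f' x) x := fun x hx ↦ hf x ⟨hs.le.trans hx.1, hx.2⟩
  have hf't : ContinuousOn f' (Icc s t) := hf'.mono (Icc_subset_Icc_left hs.le)
  -- on `(0, s)` the weight is `1/(x (1 − log(x/s))²)`
  have e0 : ∫ x in Ioo 0 s, f x ^ 2 / (x * (1 + |Real.log (x / s)|) ^ 2) =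
      ∫ x in Ioo 0 s, f x ^ 2 / (x * (1 - Real.log (x / s)) ^ 2) := by
    refine setIntegral_congr_fun measurableSet_Ioo fun x hx ↦ ?_
    have : Real.log (x / s) ≤ 0 :=
      Real.log_nonpos (div_pos hx.1 hs).le ((div_le_one hs).2 hx.2.le)
    simp only [abs_of_nonpos this, sub_eq_add_neg]
  have h1 := hardy_log_core hs hfs hf's
  have h2 := sq_le_trace hst hft hf't
  -- `∫₀ˢ x f'² ≤ s ∫₀ˢ f'²`
  have hIs : IntegrableOn (fun x ↦ f' x ^ 2) (Ioo 0 s) :=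
    ((hf's.pow 2).integrableOn_compact isCompact_Icc).mono_set Ioo_subset_Icc_self
  have h3 : ∫ x in Ioo 0 s, x * f' x ^ 2 ≤ s * ∫ x in Ioo 0 s, f' x ^ 2 := by
    rw [← MeasureTheory.integral_const_mul]
    refine setIntegral_mono_on ?_ (hIs.const_mul s) measurableSet_Ioo fun x hx ↦
      mul_le_mul_of_nonneg_right hx.2.le (sq_nonneg _)
    exact ((continuousOn_id.mul (hf's.pow 2)).integrableOn_compact isCompact_Icc).mono_set
      Ioo_subset_Icc_self
  -- `∫₀ᵗ f'² = ∫₀ˢ f'² + ∫ₛᵗ f'²`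
  have h4 : ∫ x in Ioo 0 t, f' x ^ 2 = (∫ x in Ioo 0 s, f' x ^ 2) + ∫ x in Ioo s t, f' x ^ 2 := by
    have hi1 : IntervalIntegrable (fun x ↦ f' x ^ 2) volume 0 s :=
      (hf's.pow 2).intervalIntegrable_of_Icc hs.le
    have hi2 : IntervalIntegrable (fun x ↦ f' x ^ 2) volume s t :=
      (hf't.pow 2).intervalIntegrable_of_Icc hst.le
    have := intervalIntegral.integral_add_adjacent_intervals hi1 hi2
    rw [intervalIntegral.integral_of_le hs.le, intervalIntegral.integral_of_le hst.le,
      intervalIntegral.integral_of_le (hs.le.trans hst.le), integral_Ioc_eq_integral_Ioo,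
      integral_Ioc_eq_integral_Ioo, integral_Ioc_eq_integral_Ioo] at this
    exact this.symm
  have h5 : 0 ≤ ∫ x in Ioo 0 s, f' x ^ 2 :=
    setIntegral_nonneg measurableSet_Ioo fun x _ ↦ sq_nonneg _
  have h6 : 0 ≤ ∫ x in Ioo s t, f' x ^ 2 :=
    setIntegral_nonneg measurableSet_Ioo fun x _ ↦ sq_nonneg _
  have hm1 : 0 ≤ (max s (t - s) - s) * ∫ x in Ioo 0 s, f' x ^ 2 :=
    mul_nonneg (sub_nonneg.2 (le_max_left _ _)) h5
  have hm2 : 0 ≤ (max s (t - s) - (t - s)) * ∫ x in Ioo s t, f' x ^ 2 :=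
    mul_nonneg (sub_nonneg.2 (le_max_right _ _)) h6
  rw [e0, h4]
  have e2 : 2 * (2 / (t - s) * ∫ x in Ioo s t, f x ^ 2) =
      4 / (t - s) * ∫ x in Ioo s t, f x ^ 2 := by
    ring
  nlinarith [h1, h2, h3, hm1, hm2, e2]

/-- The printed shape with `C = 4` (Dafermos–Rodnianski–Shlapentokh-Rothman, arXiv:1402.7034, §4.3,
first display, weight regularised away from `0`): for `f` differentiable on `[0, 2]` with
continuous derivative, `∫₀¹ f²/(x (1 + |log x|)²) dx ≤ 4 ∫₀² (f')² dx + 4 ∫₁² f² dx`.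
[cite: DafermosRodnianskiShlapentokhrothman2014, §4.3] -/
theorem hardy_log_sq_integral_le_one_two {f f' : ℝ → ℝ}
    (hf : ∀ x ∈ Icc (0 : ℝ) 2, HasDerivAt f (f' x) x) (hf' : ContinuousOn f' (Icc 0 2)) :
    ∫ x in Ioo (0 : ℝ) 1, f x ^ 2 / (x * (1 + |Real.log x|) ^ 2) ≤
      4 * (∫ x in Ioo (0 : ℝ) 2, f' x ^ 2) + 4 * ∫ x in Ioo (1 : ℝ) 2, f x ^ 2 := by
  have h := hardy_log_sq_integral_le one_pos (by norm_num : (1 : ℝ) < 2) hf hf'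
  norm_num at h
  exact h

/-- The printed shape with the left-hand integral over all of `(0, 2)` (weight regularised away
from `0`), constants `(4, 5)`: `∫₀² f²/(x (1 + |log x|)²) ≤ 4 ∫₀² (f')² + 5 ∫₁² f²`
(on `[1, 2]` the weight is `≤ 1`). Dafermos–Rodnianski–Shlapentokh-Rothman, arXiv:1402.7034,
§4.3, first display. [cite: DafermosRodnianskiShlapentokhrothman2014, §4.3] -/
theorem hardy_log_sq_integral_Ioo_zero_two_le {f f' : ℝ → ℝ}
    (hf : ∀ x ∈ Icc (0 : ℝ) 2, HasDerivAt f (f' x) x) (hf' : ContinuousOn f' (Icc 0 2)) :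
    ∫ x in Ioo (0 : ℝ) 2, f x ^ 2 / (x * (1 + |Real.log x|) ^ 2) ≤
      4 * (∫ x in Ioo (0 : ℝ) 2, f' x ^ 2) + 5 * ∫ x in Ioo (1 : ℝ) 2, f x ^ 2 := by
  have h1 := hardy_log_sq_integral_le_one_two hf hf'
  have hfc : ContinuousOn f (Icc 0 2) := fun x hx ↦ (hf x hx).continuousAt.continuousWithinAt
  set W : ℝ → ℝ := fun x ↦ f x ^ 2 / (x * (1 + |Real.log x|) ^ 2) with hW
  -- integrability of `W` on `(0, 1]` and on `[1, 2]`
  have hW1 : IntervalIntegrable W volume 0 1 := by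
    rw [intervalIntegrable_iff_integrableOn_Ioc_of_le zero_le_one]
    have hi := integrableOn_sq_div_mul_log_sq one_pos (hfc.mono (Icc_subset_Icc_right one_le_two))
    refine hi.congr_fun (fun x hx ↦ ?_) measurableSet_Ioc
    have : Real.log x ≤ 0 := Real.log_nonpos hx.1.le hx.2
    simp only [hW, div_one, abs_of_nonpos this, sub_eq_add_neg]
  have hden : ContinuousOn (fun x : ℝ ↦ x * (1 + |Real.log x|) ^ 2) (Icc 1 2) := by
    have hlog : ContinuousOn Real.log (Icc (1 : ℝ) 2) :=
      Real.continuousOn_log.mono fun x hx ↦ by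
        simp only [mem_compl_iff, mem_singleton_iff]
        exact (one_pos.trans_le hx.1).ne'
    exact continuousOn_id.mul ((continuousOn_const.add
      (continuous_abs.comp_continuousOn hlog)).pow 2)
  have hden1 : ∀ x ∈ Icc (1 : ℝ) 2, 1 ≤ x * (1 + |Real.log x|) ^ 2 := by
    intro x hx
    have h1' : (1 : ℝ) ≤ (1 + |Real.log x|) ^ 2 := by nlinarith [abs_nonneg (Real.log x)]
    nlinarith [hx.1]
  have hWc : ContinuousOn W (Icc 1 2) :=
    ((hfc.mono (Icc_subset_Icc_left zero_le_one)).pow 2).div hden fun x hx ↦ by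
      linarith [hden1 x hx]
  have hW2 : IntervalIntegrable W volume 1 2 := hWc.intervalIntegrable_of_Icc one_le_two
  -- split the left-hand side at `x = 1`
  have hsplit : ∫ x in Ioo (0 : ℝ) 2, W x =
      (∫ x in Ioo (0 : ℝ) 1, W x) + ∫ x in Ioo (1 : ℝ) 2, W x := by
    have := intervalIntegral.integral_add_adjacent_intervals hW1 hW2
    rw [intervalIntegral.integral_of_le zero_le_one, intervalIntegral.integral_of_le one_le_two,
      intervalIntegral.integral_of_le zero_le_two, integral_Ioc_eq_integral_Ioo,
      integral_Ioc_eq_integral_Ioo, integral_Ioc_eq_integral_Ioo] at this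
    exact this.symm
  -- on `[1, 2]` the weight is at most `1`
  have hbd : ∫ x in Ioo (1 : ℝ) 2, W x ≤ ∫ x in Ioo (1 : ℝ) 2, f x ^ 2 := by
    refine setIntegral_mono_on ((hWc.integrableOn_compact isCompact_Icc).mono_set
      Ioo_subset_Icc_self) ((((hfc.mono (Icc_subset_Icc_left zero_le_one)).pow
      2).integrableOn_compact isCompact_Icc).mono_set Ioo_subset_Icc_self) measurableSet_Ioo
      fun x hx ↦ ?_
    exact div_le_self (sq_nonneg _) (hden1 x ⟨hx.1.le, hx.2.le⟩)
  simp only [hW] at hsplit hbd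
  rw [hsplit]
  linarith

/-- The printed weight itself near `0`: on `(0, 1/2]` one has `1 + |log x| ≤ 3 |log x|`
(`log 2 > 1/2`), so `∫₀^{1/2} x⁻¹ |log x|⁻² f² ≤ 36 ∫₀² (f')² + 36 ∫₁² f²` — the display of
Dafermos–Rodnianski–Shlapentokh-Rothman, arXiv:1402.7034, §4.3 with the left-hand integral taken
over `(0, 1/2]` and `C = 36`. [cite: DafermosRodnianskiShlapentokhrothman2014, §4.3] -/
theorem hardy_log_sq_integral_printed_half {f f' : ℝ → ℝ}
    (hf : ∀ x ∈ Icc (0 : ℝ) 2, HasDerivAt f (f' x) x) (hf' : ContinuousOn f' (Icc 0 2)) :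
    ∫ x in Ioo (0 : ℝ) (1 / 2), f x ^ 2 / (x * Real.log x ^ 2) ≤
      36 * (∫ x in Ioo (0 : ℝ) 2, f' x ^ 2) + 36 * ∫ x in Ioo (1 : ℝ) 2, f x ^ 2 := by
  have h1 := hardy_log_sq_integral_le_one_two hf hf'
  have hfc : ContinuousOn f (Icc 0 2) := fun x hx ↦ (hf x hx).continuousAt.continuousWithinAt
  set W : ℝ → ℝ := fun x ↦ f x ^ 2 / (x * (1 + |Real.log x|) ^ 2) with hW
  -- `W` is integrable and nonnegative on `(0, 1)`
  have hWi : IntegrableOn W (Ioo 0 1) := by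
    have hi := integrableOn_sq_div_mul_log_sq one_pos (hfc.mono (Icc_subset_Icc_right one_le_two))
    refine (hi.mono_set Ioo_subset_Ioc_self).congr_fun (fun x hx ↦ ?_) measurableSet_Ioo
    have : Real.log x ≤ 0 := Real.log_nonpos hx.1.le hx.2.le
    simp only [hW, div_one, abs_of_nonpos this, sub_eq_add_neg]
  have hW0 : ∀ x, 0 < x → 0 ≤ W x := fun x hx ↦ by
    simp only [hW]
    positivity
  -- `log 2 > 1/2`
  have hlog2 : (1 : ℝ) / 2 < Real.log 2 := lt_trans (by norm_num) Real.log_two_gt_d9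
  -- pointwise comparison of the weights on `(0, 1/2)`: `(1 + |log x|)² ≤ 9 (log x)²`
  have hcmp : ∀ x ∈ Ioo (0 : ℝ) (1 / 2), f x ^ 2 / (x * Real.log x ^ 2) ≤ 9 * W x := by
    intro x hx
    have hx0 := hx.1
    have hlx : Real.log x ≤ -Real.log 2 := by
      have := Real.log_le_log hx0 hx.2.le
      rwa [one_div, Real.log_inv] at this
    have hneg : Real.log x < 0 := by linarith
    have hD : 0 < x * (1 + |Real.log x|) ^ 2 := by positivity
    have hle : x * (1 + |Real.log x|) ^ 2 ≤ 9 * (x * Real.log x ^ 2) := by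
      have h9 : (1 + |Real.log x|) ^ 2 ≤ 9 * Real.log x ^ 2 := by
        rw [abs_of_neg hneg]
        nlinarith
      nlinarith
    calc f x ^ 2 / (x * Real.log x ^ 2) = 9 * f x ^ 2 / (9 * (x * Real.log x ^ 2)) := by
          rw [mul_div_mul_left _ _ (by norm_num : (9 : ℝ) ≠ 0)]
      _ ≤ 9 * f x ^ 2 / (x * (1 + |Real.log x|) ^ 2) :=
          div_le_div_of_nonneg_left (by positivity) hD hle
      _ = 9 * W x := by
          simp only [hW]
          ring
  have hR : 0 ≤ 36 * (∫ x in Ioo (0 : ℝ) 2, f' x ^ 2) + 36 * ∫ x in Ioo (1 : ℝ) 2, f x ^ 2 := by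
    have ha : 0 ≤ ∫ x in Ioo (0 : ℝ) 2, f' x ^ 2 :=
      setIntegral_nonneg measurableSet_Ioo fun x _ ↦ sq_nonneg _
    have hb : 0 ≤ ∫ x in Ioo (1 : ℝ) 2, f x ^ 2 :=
      setIntegral_nonneg measurableSet_Ioo fun x _ ↦ sq_nonneg _
    positivity
  by_cases hP : IntegrableOn (fun x ↦ f x ^ 2 / (x * Real.log x ^ 2)) (Ioo (0 : ℝ) (1 / 2))
  · have hsub : Ioo (0 : ℝ) (1 / 2) ⊆ Ioo 0 1 := Ioo_subset_Ioo_right (by norm_num)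
    calc ∫ x in Ioo (0 : ℝ) (1 / 2), f x ^ 2 / (x * Real.log x ^ 2)
        ≤ ∫ x in Ioo (0 : ℝ) (1 / 2), 9 * W x :=
          setIntegral_mono_on hP ((hWi.mono_set hsub).const_mul 9) measurableSet_Ioo hcmp
      _ = 9 * ∫ x in Ioo (0 : ℝ) (1 / 2), W x := MeasureTheory.integral_const_mul _ _
      _ ≤ 9 * ∫ x in Ioo (0 : ℝ) 1, W x :=
          mul_le_mul_of_nonneg_left (setIntegral_mono_set hWi
            (ae_restrict_of_forall_mem measurableSet_Ioo fun x hx ↦ hW0 x hx.1) hsub.eventuallyLE)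
            (by norm_num)
      _ ≤ 9 * (4 * (∫ x in Ioo (0 : ℝ) 2, f' x ^ 2) + 4 * ∫ x in Ioo (1 : ℝ) 2, f x ^ 2) :=
          mul_le_mul_of_nonneg_left h1 (by norm_num)
      _ = _ := by ring
  · rw [integral_undef hP]
    exact hR

end Literature.Analysis.Calculus

end
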